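import Literature.Computability.Cryptography.LWEProductLaws
import Literature.Algebra.EuclideanLattices.RegevHyperplaneEscape
import HarnessLib

/-!
# Regev 2009, Corollary 3.16: `n²` independent discrete Gaussian samples span the space

Topic `Computability/Cryptography` (family `pqc`), grouping namespace `Regev2009`. Sequel of
`Literature/Algebra/EuclideanLattices/RegevHyperplaneEscape.lean` (Lemma 3.15) in the decomposition
of the named fact `Literature.Computability.Cryptography.regev_lwe_to_sivp_quantum` (pqc.S19; Regev,
J. ACM 56 (2009), Thm 1.1): the probabilistic core of the last step `GIVP_{2√n φ} ≤ DGS_φ`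
(Lemma 3.17, hypothesis `h₃` of `regev_lwe_to_sivp_quantum_of_worstCase`,
`RegevDGSReductionWorstCase.lean`).

**Corollary 3.16** (Regev 2009, p. 21). *Let `L` be an `n`-dimensional lattice and let `r` be such
that `r ≥ √2 η_ε(L)` where `ε ≤ 1/10`. Then, the probability that a set of `n²` vectors chosen
independently from `D_{L,r}` contains no `n` linearly independent vectors is exponentially small.*

Everything here is PROVED (theorems only, no named facts), along the printed proof: split the
`n²` samples into `n` consecutive blocks of `n`; if the span is still proper after all blocks then
some block failed to increase the dimension of the span of the previous blocks while that span was a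
proper subspace `H`, i.e. all `n` samples of that block fell into `H`, which by Lemma 3.15 has
probability `≤ (9/10)ⁿ` (independence: `toOuterMeasure_iidPMF_forall`); a union bound over the `n`
blocks gives `≤ n (9/10)ⁿ`. The independent samples are the tree's iid product
`LWE.iidPMF D N : PMF (Fin N → L)` (`LWE.lean`, product laws in `LWEProductLaws.lean`), the model in
which the outputs of `N` independent runs of a sampler are read downstream.

## Main results

* `Regev2009.tupleSpan` — the `ℝ`-span of a tuple of lattice vectors; `Regev2009.deficient k` — the
  event "the span is proper and of dimension `< k`".
* `Regev2009.toOuterMeasure_iidPMF_deficient_le` — **the block induction** for an arbitrary law `D`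
  on `L` with `Pr_D[x ∈ H] ≤ q` for every proper subspace `H`: after `k` blocks of `m` samples,
  `Pr[deficient k] ≤ k · q^m`.
* `Regev2009.toOuterMeasure_iidPMF_tupleSpan_ne_top_le` — hence `Pr[span of m·n samples ≠ V] ≤ n q^m`
  (`n = dim V`).
* `Regev2009.corollary_3_16` — for `D = D_{L,r}`, `0 < ε ≤ 1/10`, `√2 η_ε(L) ≤ r`:
  `Pr[the n² samples do not span V] ≤ n · (9/10)ⁿ`; and the sharper
  `Regev2009.toOuterMeasure_iidPMF_discreteGaussian_tupleSpan_ne_top_le` with `((1 + ε)/√2)ⁿ`.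

## References

* O. Regev, *On lattices, learning with errors, random linear codes, and cryptography*, J. ACM 56
  (2009), art. 34 (author's version arXiv:2401.03703), Lemma 3.15, Corollary 3.16, Lemma 3.17, p. 21
  [Regev2009].
-/

noncomputable section

open Module MeasureTheory
open scoped ENNReal InnerProductSpace

namespace Literature.Computability.Cryptography

namespace Regev2009

open LWE Literature.Probability.Distributions Literature.Algebra.EuclideanLattices

variable {V : Type} [NormedAddCommGroup V] [InnerProductSpace ℝ V]
variable {L : Submodule ℤ V}

/-! ### Spans of tuples of lattice vectors -/

/-- The `ℝ`-linear span of a tuple `S = (x₁, …, x_N)` of lattice vectors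
(`span(x₁, …, x_N)` of the proof of Regev 2009, Cor. 3.16). [cite: Regev2009, Corollary 3.16 (proof)] -/
def tupleSpan {N : ℕ} (S : Fin N → L) : Submodule ℝ V :=
  Submodule.span ℝ (Set.range fun i => ((S i : L) : V))

/-- Every entry lies in the span. [folklore] -/
theorem subset_tupleSpan {N : ℕ} (S : Fin N → L) (i : Fin N) : ((S i : L) : V) ∈ tupleSpan S :=
  Submodule.subset_span ⟨i, rfl⟩

/-- The span of the first block is contained in the span of the concatenation. [folklore] -/
theorem tupleSpan_le_tupleSpan_append {a b : ℕ} (S : Fin a → L) (T : Fin b → L) :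
    tupleSpan S ≤ tupleSpan (Fin.append S T) := by
  refine Submodule.span_le.2 ?_
  rintro _ ⟨i, rfl⟩
  have h := subset_tupleSpan (Fin.append S T) (Fin.castAdd b i)
  rwa [Fin.append_left] at h

/-- The entries of the second block lie in the span of the concatenation. [folklore] -/
theorem append_right_mem_tupleSpan {a b : ℕ} (S : Fin a → L) (T : Fin b → L) (j : Fin b) :
    ((T j : L) : V) ∈ tupleSpan (Fin.append S T) := by
  have h := subset_tupleSpan (Fin.append S T) (Fin.natAdd a j)
  rwa [Fin.append_right] at h

/-- **The events `B_i` of the printed proof, cumulated**: after the samples `S`, the span is still a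
proper subspace AND has dimension `< k` ("fewer than `k` of the blocks so far increased the
dimension"). [cite: Regev2009, Corollary 3.16 (proof)] -/
def deficient (k : ℕ) {N : ℕ} : Set (Fin N → L) :=
  {S | tupleSpan S ≠ ⊤ ∧ finrank ℝ (tupleSpan S) < k}

/-- Nothing is deficient at level `0`. [folklore] -/
theorem deficient_zero {N : ℕ} : (deficient 0 : Set (Fin N → L)) = ∅ :=
  Set.eq_empty_of_forall_notMem fun _ h => (Nat.not_lt_zero _ h.2)

/-- **The case analysis of the printed proof.** If the concatenation `S ++ T` is deficient at level
`k + 1`, then either `S` was already deficient at level `k`, or the block `T` fell entirely into the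
proper subspace `span(S)` (the event whose probability Lemma 3.15 bounds).
[cite: Regev2009, Corollary 3.16 (proof)] -/
theorem append_mem_deficient_succ [FiniteDimensional ℝ V] {a b k : ℕ} {S : Fin a → L} {T : Fin b → L}
    (h : Fin.append S T ∈ (deficient (k + 1) : Set (Fin (a + b) → L))) :
    S ∈ (deficient k : Set (Fin a → L)) ∨
      (tupleSpan S ≠ ⊤ ∧ ∀ j, ((T j : L) : V) ∈ tupleSpan S) := by
  obtain ⟨hU, hdim⟩ := h
  have hle := tupleSpan_le_tupleSpan_append S T
  have hS : tupleSpan S ≠ ⊤ := fun hS => hU (eq_top_iff.2 (hS ▸ hle))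
  by_cases hk : finrank ℝ (tupleSpan S) < k
  · exact Or.inl ⟨hS, hk⟩
  · right
    refine ⟨hS, fun j => ?_⟩
    have heq : tupleSpan S = tupleSpan (Fin.append S T) :=
      Submodule.eq_of_le_of_finrank_le hle (by omega)
    rw [heq]
    exact append_right_mem_tupleSpan S T j

/-! ### The block induction -/

section Blocks

variable (D : PMF L) (m : ℕ) {q : ℝ≥0∞}

/-- One block of `m` independent samples falls into a fixed proper subspace `H` with probability
`≤ q^m` if one sample does with probability `≤ q` (independence, `toOuterMeasure_iidPMF_forall`).
[cite: Regev2009, Corollary 3.16 (proof: "at most (9/10)ⁿ")] -/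
theorem toOuterMeasure_iidPMF_forall_mem_le (H : Submodule ℝ V)
    (hq : D.toOuterMeasure {x : L | (x : V) ∈ H} ≤ q) :
    (iidPMF D m).toOuterMeasure {T : Fin m → L | ∀ j, ((T j : L) : V) ∈ H} ≤ q ^ m := by
  have h := toOuterMeasure_iidPMF_forall D {x : L | (x : V) ∈ H} m
  simp only [Set.mem_setOf_eq] at h
  rw [h]
  exact pow_le_pow_left' hq m

variable [FiniteDimensional ℝ V]

/-- **One more block** (the inductive step): `Pr_{m(k+1) samples}[deficient (k+1)] ≤
Pr_{mk samples}[deficient k] + q^m`, by the case analysis `append_mem_deficient_succ`, the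
independence of the last block from the first `mk` samples (`iidPMF_map_appendEquiv_symm`,
`toOuterMeasure_prodLaw_le`) and the one-block bound. [cite: Regev2009, Corollary 3.16 (proof)] -/
theorem toOuterMeasure_iidPMF_deficient_succ_le (k : ℕ)
    (hq : ∀ H : Submodule ℝ V, H ≠ ⊤ → D.toOuterMeasure {x : L | (x : V) ∈ H} ≤ q) :
    (iidPMF D (m * k + m)).toOuterMeasure (deficient (k + 1)) ≤
      (iidPMF D (m * k)).toOuterMeasure (deficient k) + q ^ m := by
  -- pass to the independent pair (first `mk` samples, last `m` samples)
  set E : Set (Fin (m * k + m) → L) := deficient (k + 1) with hE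
  set E' : Set ((Fin (m * k) → L) × (Fin m → L)) := (fun p => Fin.append p.1 p.2) ⁻¹' E with hE'
  have hlaw : (iidPMF D (m * k + m)).toOuterMeasure E =
      (prodLaw (iidPMF D (m * k)) (iidPMF D m)).toOuterMeasure E' := by
    rw [← iidPMF_map_appendEquiv_symm, PMF.toOuterMeasure_map_apply]
    congr 1
    ext U
    simp only [hE', Set.mem_preimage]
    rw [show Fin.append ((Fin.appendEquiv (m * k) m).symm U).1 ((Fin.appendEquiv (m * k) m).symm U).2 =
      Fin.appendEquiv (m * k) m ((Fin.appendEquiv (m * k) m).symm U) from rfl, Equiv.apply_symm_apply]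
  rw [hlaw]
  -- the case analysis as an inclusion of events
  set F : Set ((Fin (m * k) → L) × (Fin m → L)) :=
    {p | tupleSpan p.1 ≠ ⊤ ∧ ∀ j, ((p.2 j : L) : V) ∈ tupleSpan p.1} with hF
  have hsub : E' ⊆ Prod.fst ⁻¹' deficient k ∪ F := by
    rintro ⟨S, T⟩ hST
    rcases append_mem_deficient_succ (k := k) hST with h | h
    · exact Or.inl h
    · exact Or.inr h
  refine (measure_mono hsub).trans ((measure_union_le _ _).trans (add_le_add ?_ ?_))
  · -- first marginal
    rw [← PMF.toOuterMeasure_map_apply, prodLaw_map_fst]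
  · -- sections of `F`: a block falling into the proper subspace `span(S)`
    refine toOuterMeasure_prodLaw_le _ _ F fun S => ?_
    by_cases hS : tupleSpan S = ⊤
    · have : Prod.mk S ⁻¹' F = ∅ := Set.eq_empty_of_forall_notMem fun T hT => hT.1 hS
      rw [this, measure_empty]
      exact zero_le
    · refine le_trans (measure_mono ?_) (toOuterMeasure_iidPMF_forall_mem_le D m (tupleSpan S) (hq _ hS))
      intro T hT
      exact hT.2

/-- **The block induction** (Regev 2009, proof of Cor. 3.16: "it suffices to show that for all `i`,
`Pr[B_i] ≤ 2^{-Ω(n)}`", summed over the blocks). For any law `D` on the lattice with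
`Pr_D[x ∈ H] ≤ q` for every proper subspace `H`, after `k` blocks of `m` independent samples the
span is proper of dimension `< k` with probability `≤ k · q^m`. [cite: Regev2009, Corollary 3.16 (proof)] -/
theorem toOuterMeasure_iidPMF_deficient_le
    (hq : ∀ H : Submodule ℝ V, H ≠ ⊤ → D.toOuterMeasure {x : L | (x : V) ∈ H} ≤ q) :
    ∀ k : ℕ, (iidPMF D (m * k)).toOuterMeasure (deficient k) ≤ k * q ^ m
  | 0 => by simp [deficient_zero]
  | k + 1 => by
    have ih := toOuterMeasure_iidPMF_deficient_le hq k
    calc (iidPMF D (m * (k + 1))).toOuterMeasure (deficient (k + 1))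
        = (iidPMF D (m * k + m)).toOuterMeasure (deficient (k + 1)) := rfl
      _ ≤ (iidPMF D (m * k)).toOuterMeasure (deficient k) + q ^ m :=
          toOuterMeasure_iidPMF_deficient_succ_le D m k hq
      _ ≤ k * q ^ m + q ^ m := by gcongr
      _ = (k + 1 : ℕ) * q ^ m := by push_cast; ring

/-- **`Pr[m·n independent samples do not span V] ≤ n · q^m`** (`n = dim V`): a proper span has
dimension `< n`, so "not spanning after `n` blocks" is `deficient n`. [cite: Regev2009, Corollary 3.16 (proof)] -/
theorem toOuterMeasure_iidPMF_tupleSpan_ne_top_le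
    (hq : ∀ H : Submodule ℝ V, H ≠ ⊤ → D.toOuterMeasure {x : L | (x : V) ∈ H} ≤ q) :
    (iidPMF D (m * finrank ℝ V)).toOuterMeasure {S | tupleSpan S ≠ ⊤} ≤ finrank ℝ V * q ^ m := by
  refine le_trans (measure_mono fun S hS => ?_) (toOuterMeasure_iidPMF_deficient_le D m hq (finrank ℝ V))
  exact ⟨hS, Submodule.finrank_lt hS⟩

end Blocks

/-! ### Corollary 3.16 -/

section DiscreteGaussian

variable [FiniteDimensional ℝ V] (L) [DiscreteTopology L] [IsZLattice ℝ L]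

/-- **Regev 2009, Corollary 3.16 (quantitative form).** For a full-rank lattice `L` in dimension `n`,
`0 < ε`, `0 < r` with `√2 η_ε(L) ≤ r`: `n²` independent samples from `D_{L,r}` fail to span `V` with
probability at most `n · ((1 + ε)/√2)ⁿ` (Lemma 3.15 in each of `n` blocks of `n`).
[cite: Regev2009, Corollary 3.16] -/
theorem toOuterMeasure_iidPMF_discreteGaussian_tupleSpan_ne_top_le {ε r : ℝ} (hε : 0 < ε) (hr : 0 < r)
    (hηr : Real.sqrt 2 * smoothingParameter L ε ≤ r) :
    (iidPMF (discreteGaussian L r 0) (finrank ℝ V * finrank ℝ V)).toOuterMeasure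
        {S | tupleSpan S ≠ ⊤} ≤
      finrank ℝ V * ENNReal.ofReal ((1 + ε) / Real.sqrt 2) ^ finrank ℝ V := by
  refine toOuterMeasure_iidPMF_tupleSpan_ne_top_le (discreteGaussian L r 0) (finrank ℝ V) fun H hH => ?_
  rw [ENNReal.le_ofReal_iff_toReal_le ?_ (by positivity)]
  · exact Literature.Algebra.EuclideanLattices.Regev2009.toOuterMeasure_discreteGaussian_mem_submodule_le
      L hε hr hηr hH
  · exact ne_top_of_le_ne_top ENNReal.one_ne_top
      ((PMF.toOuterMeasure_mono _ (Set.subset_univ _)).trans_eq (PMF.toOuterMeasure_apply_eq_one_iff _ _ |>.2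
        (Set.subset_univ _)))

/-- **Regev 2009, Corollary 3.16 (as printed, with the explicit exponential bound of its proof).**
*Let `L` be an `n`-dimensional lattice and let `r` be such that `r ≥ √2 η_ε(L)` where `ε ≤ 1/10`.
Then, the probability that a set of `n²` vectors chosen independently from `D_{L,r}` contains no `n`
linearly independent vectors is exponentially small* — here: at most `n · (9/10)ⁿ`. "Contains `n`
linearly independent vectors" is rendered as "spans `V`" (`n = dim V`); the `n²` independent samples
are the iid product `LWE.iidPMF (D_{L,r}) (n·n)`; `0 < ε` and `0 < r` are the standing conventions of
the paper (`η_ε` is used with `ε > 0`; `r ≥ √2 η_ε(L) > 0` in any dimension `n ≥ 1`).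
[cite: Regev2009, Corollary 3.16] -/
theorem corollary_3_16 {ε r : ℝ} (hε : 0 < ε) (hε10 : ε ≤ 1 / 10) (hr : 0 < r)
    (hηr : Real.sqrt 2 * smoothingParameter L ε ≤ r) :
    ((iidPMF (discreteGaussian L r 0) (finrank ℝ V * finrank ℝ V)).toOuterMeasure
        {S | tupleSpan S ≠ ⊤}).toReal ≤ finrank ℝ V * (9 / 10 : ℝ) ^ finrank ℝ V := by
  have h := toOuterMeasure_iidPMF_discreteGaussian_tupleSpan_ne_top_le L hε hr hηr
  -- `(1 + ε)/√2 ≤ 9/10`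
  have hsqrt : (1.4 : ℝ) ≤ Real.sqrt 2 := by
    rw [Real.le_sqrt (by norm_num) (by norm_num)]; norm_num
  have hc0 : 0 ≤ (1 + ε) / Real.sqrt 2 := by positivity
  have h9 : (1 + ε) / Real.sqrt 2 ≤ 9 / 10 := by
    rw [div_le_iff₀ (by positivity)]
    nlinarith
  have h' : (iidPMF (discreteGaussian L r 0) (finrank ℝ V * finrank ℝ V)).toOuterMeasure
      {S | tupleSpan S ≠ ⊤} ≤ ENNReal.ofReal (finrank ℝ V * (9 / 10 : ℝ) ^ finrank ℝ V) := by
    refine h.trans ?_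
    rw [ENNReal.ofReal_mul (by positivity), ENNReal.ofReal_natCast, ENNReal.ofReal_pow (by norm_num)]
    gcongr
  exact ENNReal.toReal_le_of_le_ofReal (by positivity) h'

end DiscreteGaussian

end Regev2009

end Literature.Computability.Cryptography

end
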